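import Mathlib
import Summits.NavierStokesRegularity.NavierStokesRegularity.Theorems.EulerZoomLiouvillePowerGaugeEulerLiouvillePressureBudgetLiouvilleModConstTools
import HarnessLib

/-!
# Crux `EulerZoomLiouville.PowerGaugeEulerLiouville` (stmt-NavierStokesRegularity-19832): t60-ΠLOG piece S5 — `LiouvilleModConst ρ`

Width/portrait piece (`--supports stmt-NavierStokesRegularity-19832 --as helper`; LEAD 19832 ns-typeII-p2 g16 KEY S58c-5, 12:31:27Z) of nsreg-p2's
instrument t60-ΠLOG (`r58/Sketch58c.lean` c6fe466b7b48535d, namespace `NsregP2.R58c`).  Piece **S5 `LiouvilleModConst ρ`: UNIQUENESS MODULO CONSTANTS**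
for the pressure Poisson equation `−ΔP = ∂ᵢ∂ⱼ(VᵢVⱼ)` — two distributional solutions, one `C¹` with `∫_{B_R} ‖∇P‖ ≤ D R^{3−ρ/2}`, one locally
integrable with mean oscillation `∫_{B_R} |Q − c_R| ≤ D R^m`, `m < 4`, differ a.e. by a constant when `0 < ρ` (the text also carries `ρ < 2`, unused
by this proof) — with `SolvesPressurePoisson` δ-UNFOLDED (the file stays definition-free).

Proof: `h = P − Q` is distributionally harmonic (subtract the two weak equations); for a bump `φ` the mollification `H = φ̃ ⋆ h` is harmonic
(Weyl, `ConvolutionLaplacian.harmonicOnNhd_convolution`), and by the probe formula `∇H(y)·a = ∫ ∇χ_R(z)·a · H(y − z) dz`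
(`HarmonicProbe.fderiv_harmonic_eq_integral_probeBump`) with `H = φ̃ ⋆ P − φ̃ ⋆ Q`:
* the `Q`-part is `∫ ∇χ_R·a · ((φ̃ ⋆ Q)(y − z) − c) dz` (`∫ ∇χ_R = 0`), at most `C R⁻⁴ ‖a‖ ∫_{B_S} |Q − c_S| ≤ C′ ‖a‖ S^{m−4}` (local Young,
  `PressureSeam.setIntegral_abs_normed_convolution_sub_const_le`);
* the `P`-part is moved onto `P` by parts, `∫ χ_R(z) ∇(φ̃ ⋆ P)(y − z)·a dz`, and `|∇(φ̃ ⋆ P)·a| ≤ ‖a‖ φ̃ ⋆ ‖∇P‖`, so it is at most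
  `(m R³)⁻¹ ‖a‖ ∫_{B_S} ‖∇P‖ ≤ C″ ‖a‖ S^{−ρ/2}`;
with `R = S/3 → ∞`: `∇H ≡ 0`, every mollification is constant, and bumps `→ δ` (`ConvolutionLaplacian.ae_eq_const_of_forall_convolution_normed_const`).

* ★ `liouvilleModConst (ρ : ℝ) : <NsregP2.R58c.LiouvilleModConst ρ unfolded>`; by-name check
  `example (ρ) : NsregP2.R58c.LiouvilleModConst ρ := PressureSeam.liouvilleModConst ρ`.

HONEST FRAMING: a portrait instrument piece (uniqueness bookkeeping for the pressure of HYPOTHETICAL profiles); nothing here bears on the crux E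
(19832 OPEN) or on NS regularity; not E. [cite: GilbargTrudinger2001, Thm 2.10; Evans2010, App. C.4 Thm. 7] [nsreg-p2 R58 S58c-5; folklore]
-/

noncomputable section

set_option linter.dupNamespace false

open MeasureTheory Set Filter Topology Metric Function InnerProductSpace
open scoped NNReal ENNReal Topology Convolution ContDiff Laplacian

namespace Summit.NavierStokesRegularity.NavierStokesRegularity.Theorems.PowerGaugeEulerLiouville.PressureSeam

open Literature.Analysis Literature.Analysis.FluidPDE Literature.Analysis.FunctionSpaces ContinuousLinearMap

/-- The normalised bump vanishes off the ball of radius `r_φ`. [folklore] -/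
theorem normed_eq_zero_of_rOut_lt (φ : ContDiffBump (0 : EuclideanSpace ℝ (Fin 3))) (z : EuclideanSpace ℝ (Fin 3))
    (hz : φ.rOut < ‖z‖) : φ.normed volume z = 0 := by
  have h : z ∉ Function.support (φ.normed volume) := by
    rw [φ.support_normed_eq, mem_ball_zero_iff, not_lt]
    exact hz.le
  simpa [Function.mem_support] using h

/-- **The probe integral against a continuous function, modulo constants**: for continuous `F`, `R > 0`, any `c` and any direction `a`,
`|∫ ∇χ_R(z)·a · F(y − z) dz| ≤ (m R³)⁻¹ R⁻¹ C_θ ‖a‖ ∫_{B̄(0,2R)} |F(y − z) − c| dz` (`∫ ∇χ_R·a = 0` removes the constant; `‖∇χ_R‖ ≤ (m R³)⁻¹R⁻¹C_θ`,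
`supp χ_R ⊆ B̄(0,2R)`). [cite: GilbargTrudinger2001, Thm 2.10] -/
theorem abs_integral_fderiv_probeBump_mul_le {F : EuclideanSpace ℝ (Fin 3) → ℝ} (hF : Continuous F)
    {Cθ : ℝ} (hCθ : ∀ x : EuclideanSpace ℝ (Fin 3), ‖fderiv ℝ baseBump x‖ ≤ Cθ) {R : ℝ} (hR : 0 < R)
    (y a : EuclideanSpace ℝ (Fin 3)) (c : ℝ) :
    |∫ z, fderiv ℝ (probeBump R) z a * F (y - z)| ≤ (baseBumpMass (EuclideanSpace ℝ (Fin 3)) * R ^ 3)⁻¹ * R⁻¹ * Cθ * ‖a‖ *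
      ∫ z in closedBall (0 : EuclideanSpace ℝ (Fin 3)) (2 * R), |F (y - z) - c| := by
  have hd : Module.finrank ℝ (EuclideanSpace ℝ (Fin 3)) = 3 := by simp
  set m := baseBumpMass (EuclideanSpace ℝ (Fin 3)) with hm
  have hm0 : 0 < m := baseBumpMass_pos
  have hC0 : 0 ≤ Cθ := (norm_nonneg _).trans (hCθ 0)
  set k := (m * R ^ 3)⁻¹ * R⁻¹ * Cθ with hk
  have hk0 : 0 ≤ k := by positivity
  have hDχ : ∀ z : EuclideanSpace ℝ (Fin 3), ‖fderiv ℝ (probeBump R) z‖ ≤ k := fun z => by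
    have h := norm_fderiv_probeBump_le hR hCθ z
    rwa [hd] at h
  have hχ1 : ContDiff ℝ 1 (probeBump (E := EuclideanSpace ℝ (Fin 3)) R) := contDiff_probeBump R
  have hχc : HasCompactSupport (probeBump (E := EuclideanSpace ℝ (Fin 3)) R) := hasCompactSupport_probeBump hR
  have hDχc : Continuous fun z => fderiv ℝ (probeBump (E := EuclideanSpace ℝ (Fin 3)) R) z a :=
    (hχ1.continuous_fderiv one_ne_zero).clm_apply continuous_const
  have hDχs : HasCompactSupport fun z => fderiv ℝ (probeBump (E := EuclideanSpace ℝ (Fin 3)) R) z a :=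
    hχc.fderiv_apply (𝕜 := ℝ) a
  have hFy : Continuous fun z => F (y - z) := hF.comp (continuous_const.sub continuous_id)
  -- remove the constant
  have hI1 : Integrable (fun z => fderiv ℝ (probeBump R) z a * F (y - z)) := (hDχc.mul hFy).integrable_of_hasCompactSupport hDχs.mul_right
  have hI2 : Integrable (fun z => fderiv ℝ (probeBump R) z a * c) := (hDχc.mul continuous_const).integrable_of_hasCompactSupport hDχs.mul_right
  have hsplit : ∫ z, fderiv ℝ (probeBump R) z a * F (y - z) = ∫ z, fderiv ℝ (probeBump R) z a * (F (y - z) - c) := by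
    have h0 : ∫ z, fderiv ℝ (probeBump R) z a * c = 0 := by
      rw [integral_mul_const, FluidPDE.integral_fderiv_apply_eq_zero hχ1 hχc a, zero_mul]
    have : (fun z => fderiv ℝ (probeBump R) z a * (F (y - z) - c)) =
        fun z => fderiv ℝ (probeBump R) z a * F (y - z) - fderiv ℝ (probeBump R) z a * c := by
      funext z; ring
    rw [this, integral_sub hI1 hI2, h0, sub_zero]
  rw [hsplit]
  -- domination by the indicator of the closed ball of radius `2R`
  set g : EuclideanSpace ℝ (Fin 3) → ℝ := fun z =>
    (closedBall (0 : EuclideanSpace ℝ (Fin 3)) (2 * R)).indicator (fun z => k * ‖a‖ * |F (y - z) - c|) z with hg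
  have hdom : ∀ z, ‖fderiv ℝ (probeBump R) z a * (F (y - z) - c)‖ ≤ g z := by
    intro z
    simp only [hg]
    by_cases hz : z ∈ closedBall (0 : EuclideanSpace ℝ (Fin 3)) (2 * R)
    · rw [indicator_of_mem hz, norm_mul, Real.norm_eq_abs, Real.norm_eq_abs]
      have h1 : |fderiv ℝ (probeBump R) z a| ≤ k * ‖a‖ := by
        rw [← Real.norm_eq_abs]
        exact (ContinuousLinearMap.le_opNorm _ _).trans (mul_le_mul_of_nonneg_right (hDχ z) (norm_nonneg _))
      exact mul_le_mul_of_nonneg_right h1 (abs_nonneg _)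
    · rw [indicator_of_notMem hz]
      have hz' : z ∉ tsupport (probeBump (E := EuclideanSpace ℝ (Fin 3)) R) := fun h => hz (tsupport_probeBump_subset hR h)
      rw [fderiv_of_notMem_tsupport ℝ hz']
      simp
  have hgi : Integrable g := by
    rw [hg, integrable_indicator_iff measurableSet_closedBall]
    exact ((continuous_const.mul (hFy.sub continuous_const).abs).continuousOn).integrableOn_compact (isCompact_closedBall _ _)
  have hint := norm_integral_le_of_norm_le hgi (Eventually.of_forall hdom)
  rw [Real.norm_eq_abs] at hint
  refine hint.trans_eq ?_
  rw [hg, integral_indicator measurableSet_closedBall, integral_const_mul]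

/-- **The gradient of a mollified `C¹` function**: `φ̃ ⋆ P` is `C¹` and `|∇(φ̃ ⋆ P)(x)·a| ≤ ‖a‖ · (φ̃ ⋆ ‖∇P‖)(x)` (differentiate under the
integral, `HarmonicProbe.fderiv_integral_smul_comp_sub_apply`). [cite: Evans2010, App. C.4 Thm. 7] -/
theorem abs_fderiv_normed_convolution_apply_le (φ : ContDiffBump (0 : EuclideanSpace ℝ (Fin 3)))
    {P : EuclideanSpace ℝ (Fin 3) → ℝ} (hP : ContDiff ℝ 1 P) (x a : EuclideanSpace ℝ (Fin 3)) :
    |fderiv ℝ (φ.normed volume ⋆ P) x a| ≤ ‖a‖ * (φ.normed volume ⋆ fun w => ‖fderiv ℝ P w‖) x := by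
  have hconv : (φ.normed volume ⋆ P) = fun x => ∫ z, φ.normed volume z • P (x - z) := by
    funext x
    rw [convolution_lsmul]
  have hk : Integrable (φ.normed volume) volume := φ.integrable_normed
  have hkρ : ∀ z : EuclideanSpace ℝ (Fin 3), φ.rOut < ‖z‖ → φ.normed volume z = 0 := normed_eq_zero_of_rOut_lt φ
  rw [hconv, fderiv_integral_smul_comp_sub_apply hk hkρ hP x a, convolution_lsmul]
  have hDP : Continuous (fderiv ℝ P) := hP.continuous_fderiv one_ne_zero
  have hN : Continuous fun w => ‖fderiv ℝ P w‖ := hDP.norm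
  have hIi : Integrable (fun z => φ.normed volume z • ‖fderiv ℝ P (x - z)‖) volume :=
    integrable_smul_comp_sub hk hkρ hN x
  have hdom : ∀ z, ‖φ.normed volume z • fderiv ℝ P (x - z) a‖ ≤ ‖a‖ * (φ.normed volume z • ‖fderiv ℝ P (x - z)‖) := by
    intro z
    rw [smul_eq_mul, smul_eq_mul, norm_mul, Real.norm_eq_abs, abs_of_nonneg (φ.nonneg_normed z)]
    calc φ.normed volume z * ‖fderiv ℝ P (x - z) a‖ ≤ φ.normed volume z * (‖fderiv ℝ P (x - z)‖ * ‖a‖) :=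
          mul_le_mul_of_nonneg_left (ContinuousLinearMap.le_opNorm _ _) (φ.nonneg_normed z)
      _ = ‖a‖ * (φ.normed volume z * ‖fderiv ℝ P (x - z)‖) := by ring
  have hint := norm_integral_le_of_norm_le (hIi.const_mul ‖a‖) (Eventually.of_forall hdom)
  rw [Real.norm_eq_abs, integral_const_mul] at hint
  exact hint

/-- **The `P`-part of the probe integral**: for `P ∈ C¹` and `‖y‖ + 2R + r_φ < S`,
`|∫ χ_R(z) ∇(φ̃ ⋆ P)(y − z)·a dz| ≤ (m R³)⁻¹ ‖a‖ ∫_{B_S} ‖∇P‖` (`|χ_R| ≤ (m R³)⁻¹` on `B̄(0,2R)`, `|∇(φ̃ ⋆ P)·a| ≤ ‖a‖ φ̃ ⋆ ‖∇P‖`, and local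
Young `setIntegral_abs_normed_convolution_sub_const_le` with `c = 0`). [cite: Evans2010, App. C.4 Thm. 7] -/
theorem abs_integral_probeBump_mul_fderiv_le (φ : ContDiffBump (0 : EuclideanSpace ℝ (Fin 3)))
    {P : EuclideanSpace ℝ (Fin 3) → ℝ} (hP : ContDiff ℝ 1 P) {R S : ℝ} (hR : 0 < R) {y : EuclideanSpace ℝ (Fin 3)}
    (hS : ‖y‖ + 2 * R + φ.rOut < S) (a : EuclideanSpace ℝ (Fin 3)) :
    |∫ z, probeBump R z * fderiv ℝ (φ.normed volume ⋆ P) (y - z) a| ≤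
      (baseBumpMass (EuclideanSpace ℝ (Fin 3)) * R ^ 3)⁻¹ * ‖a‖ *
        ∫ w in ball (0 : EuclideanSpace ℝ (Fin 3)) S, ‖fderiv ℝ P w‖ := by
  have hd : Module.finrank ℝ (EuclideanSpace ℝ (Fin 3)) = 3 := by simp
  set m := baseBumpMass (EuclideanSpace ℝ (Fin 3)) with hm
  have hm0 : 0 < m := baseBumpMass_pos
  set N : EuclideanSpace ℝ (Fin 3) → ℝ := fun w => ‖fderiv ℝ P w‖ with hN
  have hNc : Continuous N := (hP.continuous_fderiv one_ne_zero).norm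
  have hNli : LocallyIntegrable N volume := hNc.locallyIntegrable
  set FN : EuclideanSpace ℝ (Fin 3) → ℝ := φ.normed volume ⋆ N with hFN
  have hFNc : Continuous FN :=
    (φ.hasCompactSupport_normed.contDiff_convolution_left (lsmul ℝ ℝ) (φ.contDiff_normed (n := 1)) hNli).continuous
  have hχ : ∀ z ∈ closedBall (0 : EuclideanSpace ℝ (Fin 3)) (2 * R), |probeBump R z| ≤ (m * R ^ 3)⁻¹ := fun z _ => by
    have h := abs_probeBump_le hR z
    rwa [hd] at h
  -- domination by the indicator of the closed ball of radius `2R`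
  set g : EuclideanSpace ℝ (Fin 3) → ℝ := fun z =>
    (closedBall (0 : EuclideanSpace ℝ (Fin 3)) (2 * R)).indicator (fun z => (m * R ^ 3)⁻¹ * ‖a‖ * |FN (y - z) - 0|) z with hg
  have hdom : ∀ z, ‖probeBump R z * fderiv ℝ (φ.normed volume ⋆ P) (y - z) a‖ ≤ g z := by
    intro z
    simp only [hg]
    by_cases hz : z ∈ closedBall (0 : EuclideanSpace ℝ (Fin 3)) (2 * R)
    · rw [indicator_of_mem hz, norm_mul, Real.norm_eq_abs, Real.norm_eq_abs, mul_assoc]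
      refine mul_le_mul (hχ z hz) ?_ (abs_nonneg _) (by positivity)
      refine (abs_fderiv_normed_convolution_apply_le φ hP (y - z) a).trans ?_
      rw [sub_zero]
      exact mul_le_mul_of_nonneg_left (le_abs_self _) (norm_nonneg _)
    · rw [indicator_of_notMem hz]
      rw [mem_closedBall_zero_iff, not_le] at hz
      rw [probeBump_eq_zero hR hz.le, zero_mul, norm_zero]
  have hgi : Integrable g := by
    rw [hg, integrable_indicator_iff measurableSet_closedBall]
    exact ((continuous_const.mul ((hFNc.comp (continuous_const.sub continuous_id)).sub
      continuous_const).abs).continuousOn).integrableOn_compact (isCompact_closedBall _ _)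
  have hint := norm_integral_le_of_norm_le hgi (Eventually.of_forall hdom)
  rw [Real.norm_eq_abs] at hint
  refine hint.trans ?_
  rw [hg, integral_indicator measurableSet_closedBall, integral_const_mul]
  refine mul_le_mul_of_nonneg_left ?_ (by positivity)
  have h := setIntegral_abs_normed_convolution_sub_const_le φ hNli hS 0
  simp only [hN, sub_zero, abs_norm] at h ⊢
  exact h

/-- **The mollified difference is the difference of the mollifications** (`P ∈ C⁰`, `Q ∈ L¹_loc`). [folklore] -/
theorem normed_convolution_sub_apply (φ : ContDiffBump (0 : EuclideanSpace ℝ (Fin 3)))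
    {P Q : EuclideanSpace ℝ (Fin 3) → ℝ} (hP : Continuous P) (hQ : LocallyIntegrable Q volume) (x : EuclideanSpace ℝ (Fin 3)) :
    (φ.normed volume ⋆ fun w => P w - Q w) x = (φ.normed volume ⋆ P) x - (φ.normed volume ⋆ Q) x := by
  simp only [convolution_lsmul]
  have hIP : Integrable (fun t => φ.normed volume t • P (x - t)) volume :=
    φ.hasCompactSupport_normed.convolutionExists_left (lsmul ℝ ℝ) φ.continuous_normed hP.locallyIntegrable x
  have hIQ : Integrable (fun t => φ.normed volume t • Q (x - t)) volume :=
    φ.hasCompactSupport_normed.convolutionExists_left (lsmul ℝ ℝ) φ.continuous_normed hQ x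
  have hpt : (fun t => φ.normed volume t • (P (x - t) - Q (x - t))) =
      fun t => φ.normed volume t • P (x - t) - φ.normed volume t • Q (x - t) := by
    funext t
    rw [smul_sub]
  rw [hpt, integral_sub hIP hIQ]

/-- **The two-part gradient bound**: if `H = φ̃ ⋆ (P − Q)` is harmonic (`P ∈ C¹`, `Q ∈ L¹_loc`), `R > 0`, `‖y‖ + 2R + r_φ < S`, then for any `c`
`|∇H(y)·a| ≤ (m R³)⁻¹ ‖a‖ ∫_{B_S} ‖∇P‖ + (m R³)⁻¹ R⁻¹ C_θ ‖a‖ ∫_{B_S} |Q − c|` (probe formula, split `H = φ̃ ⋆ P − φ̃ ⋆ Q`, parts on the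
`P`-term, constants off the `Q`-term, local Young). [cite: GilbargTrudinger2001, Thm 2.10] -/
theorem abs_fderiv_normed_convolution_sub_le (φ : ContDiffBump (0 : EuclideanSpace ℝ (Fin 3)))
    {P Q : EuclideanSpace ℝ (Fin 3) → ℝ} (hP : ContDiff ℝ 1 P) (hQ : LocallyIntegrable Q volume)
    (hH : HarmonicOnNhd (φ.normed volume ⋆ fun w => P w - Q w) univ)
    {Cθ : ℝ} (hCθ : ∀ x : EuclideanSpace ℝ (Fin 3), ‖fderiv ℝ baseBump x‖ ≤ Cθ) {R S : ℝ} (hR : 0 < R)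
    {y : EuclideanSpace ℝ (Fin 3)} (hS : ‖y‖ + 2 * R + φ.rOut < S) (a : EuclideanSpace ℝ (Fin 3)) (c : ℝ) :
    |fderiv ℝ (φ.normed volume ⋆ fun w => P w - Q w) y a| ≤
      (baseBumpMass (EuclideanSpace ℝ (Fin 3)) * R ^ 3)⁻¹ * ‖a‖ * (∫ w in ball (0 : EuclideanSpace ℝ (Fin 3)) S, ‖fderiv ℝ P w‖) +
        (baseBumpMass (EuclideanSpace ℝ (Fin 3)) * R ^ 3)⁻¹ * R⁻¹ * Cθ * ‖a‖ *
          ∫ w in ball (0 : EuclideanSpace ℝ (Fin 3)) S, |Q w - c| := by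
  set FP : EuclideanSpace ℝ (Fin 3) → ℝ := φ.normed volume ⋆ P with hFP
  set FQ : EuclideanSpace ℝ (Fin 3) → ℝ := φ.normed volume ⋆ Q with hFQ
  have hPli : LocallyIntegrable P volume := hP.continuous.locallyIntegrable
  have hFP1 : ContDiff ℝ 1 FP :=
    φ.hasCompactSupport_normed.contDiff_convolution_left (lsmul ℝ ℝ) (φ.contDiff_normed (n := 1)) hPli
  have hFQc : Continuous FQ :=
    (φ.hasCompactSupport_normed.contDiff_convolution_left (lsmul ℝ ℝ) (φ.contDiff_normed (n := 1)) hQ).continuous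
  have hχ1 : ContDiff ℝ 1 (probeBump (E := EuclideanSpace ℝ (Fin 3)) R) := contDiff_probeBump R
  have hχc : HasCompactSupport (probeBump (E := EuclideanSpace ℝ (Fin 3)) R) := hasCompactSupport_probeBump hR
  have hDχc : Continuous fun z => fderiv ℝ (probeBump (E := EuclideanSpace ℝ (Fin 3)) R) z a :=
    (hχ1.continuous_fderiv one_ne_zero).clm_apply continuous_const
  have hDχs : HasCompactSupport fun z => fderiv ℝ (probeBump (E := EuclideanSpace ℝ (Fin 3)) R) z a :=
    hχc.fderiv_apply (𝕜 := ℝ) a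
  have hIP : Integrable (fun z => fderiv ℝ (probeBump R) z a * FP (y - z)) :=
    (hDχc.mul (hFP1.continuous.comp (continuous_const.sub continuous_id))).integrable_of_hasCompactSupport hDχs.mul_right
  have hIQ : Integrable (fun z => fderiv ℝ (probeBump R) z a * FQ (y - z)) :=
    (hDχc.mul (hFQc.comp (continuous_const.sub continuous_id))).integrable_of_hasCompactSupport hDχs.mul_right
  -- the probe formula and the split
  rw [fderiv_harmonic_eq_integral_probeBump hH hR y a]
  have hsplit : (fun z => fderiv ℝ (probeBump R) z a * (φ.normed volume ⋆ fun w => P w - Q w) (y - z)) =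
      fun z => fderiv ℝ (probeBump R) z a * FP (y - z) - fderiv ℝ (probeBump R) z a * FQ (y - z) := by
    funext z
    rw [normed_convolution_sub_apply φ hP.continuous hQ (y - z), mul_sub]
  rw [hsplit, integral_sub hIP hIQ]
  -- the two parts
  have hPterm : |∫ z, fderiv ℝ (probeBump R) z a * FP (y - z)| ≤
      (baseBumpMass (EuclideanSpace ℝ (Fin 3)) * R ^ 3)⁻¹ * ‖a‖ *
        ∫ w in ball (0 : EuclideanSpace ℝ (Fin 3)) S, ‖fderiv ℝ P w‖ := by
    rw [integral_fderiv_mul_comp_sub hχ1 hχc hFP1 y a]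
    exact abs_integral_probeBump_mul_fderiv_le φ hP hR hS a
  have hQterm : |∫ z, fderiv ℝ (probeBump R) z a * FQ (y - z)| ≤
      (baseBumpMass (EuclideanSpace ℝ (Fin 3)) * R ^ 3)⁻¹ * R⁻¹ * Cθ * ‖a‖ *
        ∫ w in ball (0 : EuclideanSpace ℝ (Fin 3)) S, |Q w - c| := by
    have hC0 : 0 ≤ Cθ := (norm_nonneg _).trans (hCθ 0)
    have hm0 : 0 < baseBumpMass (EuclideanSpace ℝ (Fin 3)) := baseBumpMass_pos
    refine (abs_integral_fderiv_probeBump_mul_le hFQc hCθ hR y a c).trans ?_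
    exact mul_le_mul_of_nonneg_left (setIntegral_abs_normed_convolution_sub_const_le φ hQ hS c) (by positivity)
  exact (abs_sub _ _).trans (add_le_add hPterm hQterm)

/-- ★ **The Liouville tool, two-budget form**: `P ∈ C¹` with `∫_{B_R} ‖∇P‖ ≤ G₁(R)`, `G₁(R)/R³ → 0`, `Q ∈ L¹_loc` with mean oscillation
`∫_{B_R} |Q − c_R| ≤ G₂(R)`, `G₂(R)/R⁴ → 0`, and `P − Q` distributionally harmonic ⟹ `P − Q` is a.e. constant (every mollification
`φ̃ ⋆ (P − Q)` is harmonic with `|∇(φ̃ ⋆ (P − Q))(y)·a| ≤ 27 m⁻¹‖a‖ G₁(S)/S³ + 81 m⁻¹C_θ‖a‖ G₂(S)/S⁴ → 0`, hence constant; bumps `→ δ`).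
[cite: GilbargTrudinger2001, Thm 2.10; Evans2010, App. C.4 Thm. 7] -/
theorem ae_const_sub_of_gradient_of_oscillation {P Q : EuclideanSpace ℝ (Fin 3) → ℝ} (hP : ContDiff ℝ 1 P)
    (hQ : LocallyIntegrable Q volume)
    (hharm : ∀ ψ : EuclideanSpace ℝ (Fin 3) → ℝ, ContDiff ℝ (⊤ : ℕ∞) ψ → HasCompactSupport ψ →
      ∫ x, (P x - Q x) * (Δ ψ) x = 0)
    {G₁ : ℝ → ℝ} (hG₁ : ∀ R : ℝ, 1 ≤ R → ∫ y in ball (0 : EuclideanSpace ℝ (Fin 3)) R, ‖fderiv ℝ P y‖ ≤ G₁ R)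
    (hG₁lim : Tendsto (fun R => G₁ R / R ^ 3) atTop (𝓝 0))
    {G₂ : ℝ → ℝ} (hG₂ : ∀ R : ℝ, 1 ≤ R → ∃ c : ℝ, ∫ y in ball (0 : EuclideanSpace ℝ (Fin 3)) R, |Q y - c| ≤ G₂ R)
    (hG₂lim : Tendsto (fun R => G₂ R / R ^ 4) atTop (𝓝 0)) :
    ∃ κ : ℝ, ∀ᵐ x ∂(volume : Measure (EuclideanSpace ℝ (Fin 3))), P x - Q x = κ := by
  have hh : LocallyIntegrable (fun w => P w - Q w) volume := hP.continuous.locallyIntegrable.sub hQ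
  refine ConvolutionLaplacian.ae_eq_const_of_forall_convolution_normed_const hh fun φ _ => ?_
  set H : EuclideanSpace ℝ (Fin 3) → ℝ := φ.normed volume ⋆ fun w => P w - Q w with hH
  have hHharm : HarmonicOnNhd H univ :=
    ConvolutionLaplacian.harmonicOnNhd_convolution hh hharm φ.contDiff_normed φ.hasCompactSupport_normed
  have hHd : Differentiable ℝ H :=
    (φ.hasCompactSupport_normed.contDiff_convolution_left (lsmul ℝ ℝ) (φ.contDiff_normed (n := 1)) hh).differentiable
      (by norm_num)
  obtain ⟨Cθ, hCθ⟩ := (exists_bound_baseBump_derivs (E := EuclideanSpace ℝ (Fin 3))).1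
  have hC0 : 0 ≤ Cθ := (norm_nonneg _).trans (hCθ 0)
  set m := baseBumpMass (EuclideanSpace ℝ (Fin 3)) with hm
  have hm0 : 0 < m := baseBumpMass_pos
  have key : ∀ y a : EuclideanSpace ℝ (Fin 3), fderiv ℝ H y a = 0 := by
    intro y a
    set K₁ : ℝ := 27 * (m⁻¹ * ‖a‖) with hK₁
    set K₂ : ℝ := 81 * (m⁻¹ * Cθ * ‖a‖) with hK₂
    have hev : ∀ᶠ S in atTop, |fderiv ℝ H y a| ≤ K₁ * (G₁ S / S ^ 3) + K₂ * (G₂ S / S ^ 4) := by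
      filter_upwards [eventually_gt_atTop (3 * (‖y‖ + φ.rOut) + 3), eventually_ge_atTop (1 : ℝ)] with S hS hS1
      have hS0 : 0 < S := by linarith
      set R : ℝ := S / 3 with hR
      have hR0 : 0 < R := by positivity
      have hRS : ‖y‖ + 2 * R + φ.rOut < S := by rw [hR]; linarith
      obtain ⟨c, hc⟩ := hG₂ S hS1
      have h1 := abs_fderiv_normed_convolution_sub_le φ hP hQ hHharm hCθ hR0 hRS a c
      have h3 : (m * R ^ 3)⁻¹ * ‖a‖ = K₁ / S ^ 3 := by
        rw [hK₁, hR]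
        field_simp
        ring
      have h4 : (m * R ^ 3)⁻¹ * R⁻¹ * Cθ * ‖a‖ = K₂ / S ^ 4 := by
        rw [hK₂, hR]
        field_simp
        ring
      calc |fderiv ℝ H y a|
          ≤ (m * R ^ 3)⁻¹ * ‖a‖ * (∫ w in ball (0 : EuclideanSpace ℝ (Fin 3)) S, ‖fderiv ℝ P w‖) +
              (m * R ^ 3)⁻¹ * R⁻¹ * Cθ * ‖a‖ * ∫ w in ball (0 : EuclideanSpace ℝ (Fin 3)) S, |Q w - c| := h1
        _ ≤ (m * R ^ 3)⁻¹ * ‖a‖ * G₁ S + (m * R ^ 3)⁻¹ * R⁻¹ * Cθ * ‖a‖ * G₂ S :=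
            add_le_add (mul_le_mul_of_nonneg_left (hG₁ S hS1) (by positivity))
              (mul_le_mul_of_nonneg_left hc (by positivity))
        _ = K₁ * (G₁ S / S ^ 3) + K₂ * (G₂ S / S ^ 4) := by rw [h3, h4]; ring
    have hlim : Tendsto (fun S => K₁ * (G₁ S / S ^ 3) + K₂ * (G₂ S / S ^ 4)) atTop (𝓝 0) := by
      simpa using (hG₁lim.const_mul K₁).add (hG₂lim.const_mul K₂)
    have hle : |fderiv ℝ H y a| ≤ 0 := ge_of_tendsto hlim hev
    exact abs_nonpos_iff.1 hle
  have hfd0 : ∀ y, fderiv ℝ H y = 0 := fun y => by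
    ext a
    exact key y a
  exact ⟨H 0, fun x => is_const_of_fderiv_eq_zero hHd hfd0 x 0⟩

/-- ★★ **S5 `LiouvilleModConst ρ`** (= `NsregP2.R58c.LiouvilleModConst ρ` with `SolvesPressurePoisson` δ-unfolded): UNIQUENESS MODULO CONSTANTS for
the pressure Poisson equation `−Δ· = ∂ᵢ∂ⱼ(VᵢVⱼ)` in the sense of distributions — a `C¹` solution `P` with `∫_{B_R} ‖∇P‖ ≤ D R^{3−ρ/2}` (`R ≥ 1`)
and a locally integrable solution `Q` with `∫_{B_R} |Q − c_R| ≤ D R^m` (`m < 4`) differ a.e. by a constant when `0 < ρ` (the binder `ρ < 2` of the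
text is carried but not needed by this proof): `P − Q` is distributionally harmonic, `G₁(R) = D R^{3−ρ/2} = o(R³)`, `G₂(R) = D R^m = o(R⁴)`, and
`ae_const_sub_of_gradient_of_oscillation` applies. [cite: GilbargTrudinger2001, Thm 2.10] -/
theorem liouvilleModConst (ρ : ℝ) :
    ∀ (V : EuclideanSpace ℝ (Fin 3) → EuclideanSpace ℝ (Fin 3)) (P Q : EuclideanSpace ℝ (Fin 3) → ℝ), 0 < ρ → ρ < 2 →
      ContDiff ℝ 1 P → LocallyIntegrable Q volume →
      (∀ φ : EuclideanSpace ℝ (Fin 3) → ℝ, ContDiff ℝ (⊤ : ℕ∞) φ → HasCompactSupport φ →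
        ∫ x, P x * (Δ φ) x = -∫ x, fderiv ℝ (fderiv ℝ φ) x (V x) (V x)) →
      (∀ φ : EuclideanSpace ℝ (Fin 3) → ℝ, ContDiff ℝ (⊤ : ℕ∞) φ → HasCompactSupport φ →
        ∫ x, Q x * (Δ φ) x = -∫ x, fderiv ℝ (fderiv ℝ φ) x (V x) (V x)) →
      (∃ D : ℝ, ∀ R : ℝ, 1 ≤ R → ∫ y in ball (0 : EuclideanSpace ℝ (Fin 3)) R, ‖gradient P y‖ ≤ D * R ^ (3 - ρ / 2)) →
      (∃ (D m : ℝ), m < 4 ∧ ∀ R : ℝ, 1 ≤ R → ∃ c : ℝ, ∫ y in ball (0 : EuclideanSpace ℝ (Fin 3)) R, |Q y - c| ≤ D * R ^ m) →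
      ∃ κ : ℝ, ∀ᵐ x ∂volume, P x = Q x + κ := by
  intro V P Q hρ _hρ2 hP hQ hPsol hQsol hDP hDQ
  obtain ⟨D₁, hD₁⟩ := hDP
  obtain ⟨D₂, m, hm, hD₂⟩ := hDQ
  -- `P - Q` is distributionally harmonic
  have hharm : ∀ ψ : EuclideanSpace ℝ (Fin 3) → ℝ, ContDiff ℝ (⊤ : ℕ∞) ψ → HasCompactSupport ψ →
      ∫ x, (P x - Q x) * (Δ ψ) x = 0 := by
    intro ψ hψ hψc
    have hψ2 : ContDiff ℝ 2 ψ := contDiff_infty.1 hψ 2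
    have hΔc : Continuous (Δ ψ) := FluidPDE.continuous_laplacian hψ2
    have hΔs : HasCompactSupport (Δ ψ) := hψc.mono' fun x hx => by
      contrapose! hx
      simp [FluidPDE.laplacian_eq_zero_of_notMem_tsupport hx]
    have hIP : Integrable (fun x => P x * (Δ ψ) x) := (hP.continuous.mul hΔc).integrable_of_hasCompactSupport hΔs.mul_left
    have hIQ : Integrable (fun x => Q x * (Δ ψ) x) := by
      have h := hQ.integrable_smul_right_of_hasCompactSupport hΔc hΔs
      simpa only [smul_eq_mul] using h
    have hpt : (fun x => (P x - Q x) * (Δ ψ) x) = fun x => P x * (Δ ψ) x - Q x * (Δ ψ) x := by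
      funext x
      ring
    rw [hpt, integral_sub hIP hIQ, hPsol ψ hψ hψc, hQsol ψ hψ hψc, sub_self]
  -- the two budgets
  have hgrad : ∀ y, ‖gradient P y‖ = ‖fderiv ℝ P y‖ := fun y => by
    rw [gradient, LinearIsometryEquiv.norm_map]
  have hG₁ : ∀ R : ℝ, 1 ≤ R → ∫ y in ball (0 : EuclideanSpace ℝ (Fin 3)) R, ‖fderiv ℝ P y‖ ≤ D₁ * R ^ (3 - ρ / 2) := fun R hR => by
    have h := hD₁ R hR
    simp only [hgrad] at h
    exact h
  have hG₁lim : Tendsto (fun R : ℝ => D₁ * R ^ (3 - ρ / 2) / R ^ 3) atTop (𝓝 0) := by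
    have h := (tendsto_rpow_neg_atTop (by linarith : 0 < ρ / 2)).const_mul D₁
    rw [mul_zero] at h
    refine h.congr' ?_
    filter_upwards [eventually_gt_atTop (0 : ℝ)] with R hR
    have h3 : R ^ (3 : ℝ) = R ^ 3 := by exact_mod_cast Real.rpow_natCast R 3
    rw [show (3 - ρ / 2 : ℝ) = -(ρ / 2) + 3 by ring, Real.rpow_add hR, h3]
    field_simp
  have hG₂lim : Tendsto (fun R : ℝ => D₂ * R ^ m / R ^ 4) atTop (𝓝 0) := by
    have h := (tendsto_rpow_neg_atTop (by linarith : 0 < 4 - m)).const_mul D₂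
    rw [mul_zero] at h
    refine h.congr' ?_
    filter_upwards [eventually_gt_atTop (0 : ℝ)] with R hR
    have h4 : R ^ (4 : ℝ) = R ^ 4 := by exact_mod_cast Real.rpow_natCast R 4
    have hm' : R ^ m = R ^ (-(4 - m)) * R ^ 4 := by
      rw [← h4, ← Real.rpow_add hR]
      congr 1
      ring
    rw [hm']
    field_simp
  obtain ⟨κ, hκ⟩ := ae_const_sub_of_gradient_of_oscillation (G₁ := fun R => D₁ * R ^ (3 - ρ / 2)) (G₂ := fun R => D₂ * R ^ m)
    hP hQ hharm hG₁ hG₁lim hD₂ hG₂lim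
  exact ⟨κ, hκ.mono fun x hx => by linarith⟩

end Summit.NavierStokesRegularity.NavierStokesRegularity.Theorems.PowerGaugeEulerLiouville.PressureSeam

end
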